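import Mathlib

/-!
# `FiveFoldRationingR` (stmt-AtomisticToContinuum-18071), line `Sketch` — stub `stub_ffrLens`:
# lens geometry of a bond

Support file for the skeleton of the crux `GappedShellCensus.FiveFoldRationingR`.  A bond `(y, w)`
of length `d ∈ [0.98a, 1.02a]` and a common partner `u` of both ends (both distances in
`[0.98a, 1.02a]`) give the decomposition `u - y = α (w - y) + q` with `q ⊥ (w - y)` and
`α = ⟪u - y, w - y⟫ / ⟪w - y, w - y⟫`.  Claims: `⟪q, w - y⟫ = 0`, `|α - 1/2| ≤ 21/500`,
`‖q‖² ≥ 0.69 a²`, and for two such partners `u₁, u₂` at mutual distance `≥ 0.98a` the transversal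
parts make an angle with cosine `≤ 41/100` about the bond axis.

Proof.  Write `b = w - y`, `x = u - y`, `A = ‖x‖²`, `B = ‖x - b‖²`, `D = ‖b‖² = ⟪b, b⟫`, all three
in `[0.9604 a², 1.0404 a²]`, and `P = ⟪x, b⟫ = (A + D - B) / 2` (polarization).  Then
`⟪q, b⟫ = P - (P / D) D = 0`, `α - 1/2 = (A - B) / (2D)` (so `|α - 1/2| ≤ 0.08 / (2 · 0.9604)`),
`‖q‖² = A - P² / D = (2A + 2B - D) / 4 - (A - B)² / (4D) ∈ [0.69 a², 0.8003 a²]`.  For a pair,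
`⟪q₁, q₂⟫ = ⟪x₁, x₂⟫ - P₁ P₂ / D`, i.e. `2⟪q₁, q₂⟫ = ‖q₁‖² + ‖q₂‖² - ‖x₁ - x₂‖² + (P₁ - P₂)² / D`
with `|P₁ - P₂| ≤ 0.08 a²`; with `s = ‖q₁‖, t = ‖q₂‖ ≤ 0.895 a` the convex form
`s² + t² - 0.82 s t ≤ 1.18 · 0.895² a² < 0.9604 a² - 0.0064 a² / 0.9604` closes the bound.
All scalar steps are exact rational arithmetic (`nlinarith` / `linarith` with explicit products);
the vector identities hold in any real inner product space.  Mathlib only; no named fact, no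
definition.
-/

noncomputable section

namespace Summit.AtomisticToContinuum.Crystallization.Theorems

/-! ### Vector identities (any real inner product space) -/

/-- The component of `x` orthogonal to `b` (`b` non-null), `x - (⟪x, b⟫ / ⟪b, b⟫) • b`, is
orthogonal to `b`. [folklore] -/
theorem ffrLens_inner_proj {V : Type*} [NormedAddCommGroup V] [InnerProductSpace ℝ V]
    (x b : V) (hb : inner ℝ b b ≠ 0) :
    inner ℝ (x - (inner ℝ x b / inner ℝ b b) • b) b = 0 := by
  rw [inner_sub_left, real_inner_smul_left, div_mul_cancel₀ _ hb, sub_self]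

/-- Pythagoras for the orthogonal component: `‖x - (⟪x, b⟫ / ⟪b, b⟫) • b‖² = ‖x‖² - ⟪x, b⟫² / ⟪b, b⟫`.
[folklore] -/
theorem ffrLens_norm_proj_sq {V : Type*} [NormedAddCommGroup V] [InnerProductSpace ℝ V]
    (x b : V) (hb : inner ℝ b b ≠ 0) :
    ‖x - (inner ℝ x b / inner ℝ b b) • b‖ ^ 2 = ‖x‖ ^ 2 - inner ℝ x b ^ 2 / inner ℝ b b := by
  rw [norm_sub_sq_real, real_inner_smul_right, norm_smul, mul_pow, Real.norm_eq_abs, sq_abs,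
    ← real_inner_self_eq_norm_sq b]
  field_simp
  ring

/-- The inner product of two orthogonal components:
`⟪x₁ - (⟪x₁, b⟫/⟪b, b⟫) • b, x₂ - (⟪x₂, b⟫/⟪b, b⟫) • b⟫ = ⟪x₁, x₂⟫ - ⟪x₁, b⟫ ⟪x₂, b⟫ / ⟪b, b⟫`.
[folklore] -/
theorem ffrLens_inner_proj_proj {V : Type*} [NormedAddCommGroup V] [InnerProductSpace ℝ V]
    (x₁ x₂ b : V) (hb : inner ℝ b b ≠ 0) :
    inner ℝ (x₁ - (inner ℝ x₁ b / inner ℝ b b) • b) (x₂ - (inner ℝ x₂ b / inner ℝ b b) • b) =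
      inner ℝ x₁ x₂ - inner ℝ x₁ b * inner ℝ x₂ b / inner ℝ b b := by
  simp only [inner_sub_left, inner_sub_right, real_inner_smul_left, real_inner_smul_right]
  rw [real_inner_comm x₂ b]
  field_simp
  ring

/-- Polarization: `⟪x, b⟫ = (‖x‖² + ‖b‖² - ‖x - b‖²) / 2`. [folklore] -/
theorem ffrLens_inner_eq_norm {V : Type*} [NormedAddCommGroup V] [InnerProductSpace ℝ V]
    (x b : V) : inner ℝ x b = (‖x‖ ^ 2 + ‖b‖ ^ 2 - ‖x - b‖ ^ 2) / 2 := by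
  rw [norm_sub_sq_real]
  ring

/-! ### Scalar lens arithmetic -/

/-- A length in the window `[0.98a, 1.02a]` has its square in `[0.9604 a², 1.0404 a²]`.
[folklore] -/
theorem ffrLens_sq_window {a d : ℝ} (ha : 0 < a) (h1 : a * (1 - 1 / 50) ≤ d)
    (h2 : d ≤ a * (1 + 1 / 50)) :
    2401 / 2500 * a ^ 2 ≤ d ^ 2 ∧ d ^ 2 ≤ 2601 / 2500 * a ^ 2 := by
  have h0 : (0 : ℝ) ≤ a * (1 - 1 / 50) := by positivity
  have hd : 0 ≤ d := h0.trans h1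
  have hl := mul_le_mul h1 h1 h0 hd
  have hu := mul_le_mul h2 h2 hd (by positivity)
  constructor <;> linarith [hl, hu]

/-- Axial coefficient: with `P = (A + D - B)/2` and `A, B, D` in the squared window,
`|P / D - 1/2| = |A - B| / (2D) ≤ 0.08 / (2 · 0.9604) ≤ 21/500`. [folklore] -/
theorem ffrLens_alpha_abs {a A B D P : ℝ} (ha : 0 < a)
    (hA1 : 2401 / 2500 * a ^ 2 ≤ A) (hA2 : A ≤ 2601 / 2500 * a ^ 2)
    (hB1 : 2401 / 2500 * a ^ 2 ≤ B) (hB2 : B ≤ 2601 / 2500 * a ^ 2)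
    (hD1 : 2401 / 2500 * a ^ 2 ≤ D) (hP : P = (A + D - B) / 2) :
    |P / D - 1 / 2| ≤ 21 / 500 := by
  have hDpos : 0 < D := lt_of_lt_of_le (by positivity) hD1
  rw [abs_le]
  constructor
  · rw [le_sub_iff_add_le, le_div_iff₀ hDpos]
    linarith
  · rw [sub_le_iff_le_add, div_le_iff₀ hDpos]
    linarith

/-- Transversal lower bound: with `P = (A + D - B)/2` and `A, B, D` in the squared window,
`A - P² / D ≥ 0.69 a²` (`4 (A D - P²) = D (2A + 2B - D) - (A - B)²`). [folklore] -/
theorem ffrLens_q_sq_lower {a A B D P : ℝ} (ha : 0 < a)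
    (hA1 : 2401 / 2500 * a ^ 2 ≤ A) (hA2 : A ≤ 2601 / 2500 * a ^ 2)
    (hB1 : 2401 / 2500 * a ^ 2 ≤ B) (hB2 : B ≤ 2601 / 2500 * a ^ 2)
    (hD1 : 2401 / 2500 * a ^ 2 ≤ D) (hD2 : D ≤ 2601 / 2500 * a ^ 2)
    (hP : P = (A + D - B) / 2) :
    69 / 100 * a ^ 2 ≤ A - P ^ 2 / D := by
  have hDpos : 0 < D := lt_of_lt_of_le (by positivity) hD1
  have hDne : D ≠ 0 := hDpos.ne'
  have ha2 : 0 ≤ a ^ 2 := sq_nonneg a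
  have hL : 0 ≤ 2 * A + 2 * B - D - 276 / 100 * a ^ 2 - 412 / 10000 * a ^ 2 := by linarith
  have hL0 : 0 ≤ 2 * A + 2 * B - D - 276 / 100 * a ^ 2 := by linarith
  have key : 69 / 100 * a ^ 2 * D ≤ A * D - P ^ 2 := by
    rw [hP]
    linarith [mul_nonneg (sub_nonneg.2 hD1) hL0, mul_nonneg ha2 hL,
      mul_nonneg (by linarith : 0 ≤ A - B + 2 / 25 * a ^ 2) (by linarith : 0 ≤ 2 / 25 * a ^ 2 - (A - B)),
      pow_pos ha 4]
  have hrw : A - P ^ 2 / D = (A * D - P ^ 2) / D := by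
    field_simp
  rw [hrw, le_div_iff₀ hDpos]
  exact key

/-- Transversal upper bound: with `P = (A + D - B)/2`, `A, B ≤ 1.0404 a²` and `D ≥ 0.9604 a²`,
`A - P² / D ≤ (2A + 2B - D)/4 ≤ 0.8003 a²`. [folklore] -/
theorem ffrLens_q_sq_upper {a A B D P : ℝ} (ha : 0 < a)
    (hA2 : A ≤ 2601 / 2500 * a ^ 2) (hB2 : B ≤ 2601 / 2500 * a ^ 2)
    (hD1 : 2401 / 2500 * a ^ 2 ≤ D) (hP : P = (A + D - B) / 2) :
    A - P ^ 2 / D ≤ 8003 / 10000 * a ^ 2 := by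
  have hDpos : 0 < D := lt_of_lt_of_le (by positivity) hD1
  have hDne : D ≠ 0 := hDpos.ne'
  have key : A * D - P ^ 2 ≤ 8003 / 10000 * a ^ 2 * D := by
    rw [hP]
    linarith [mul_nonneg hDpos.le (by linarith : 0 ≤ 32012 / 10000 * a ^ 2 - (2 * A + 2 * B - D)),
      sq_nonneg (A - B)]
  have hrw : A - P ^ 2 / D = (A * D - P ^ 2) / D := by
    field_simp
  rw [hrw, div_le_iff₀ hDpos]
  exact key

/-- The pair inequality in scalar form.  With `Pᵢ = (Aᵢ + D - Bᵢ)/2`, `s² = A₁ - P₁²/D`,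
`t² = A₂ - P₂²/D` (`s, t ≥ 0`), `A₁, B₁, A₂, B₂` in the squared window, `D ≥ 0.9604 a²` and
`E ≥ 0.9604 a²`: `(A₁ + A₂ - E)/2 - P₁ P₂ / D ≤ 0.41 s t`.  Route:
`2 · lhs = s² + t² - E + (P₁ - P₂)²/D`, `|P₁ - P₂| ≤ 0.08 a²`, `s, t ≤ 0.895 a`, and the
convex form `s² + t² - 0.82 s t ≤ 1.18 (0.895 a)²`. [folklore] -/
theorem ffrLens_pair_core {a A₁ B₁ A₂ B₂ D E P₁ P₂ s t : ℝ} (ha : 0 < a)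
    (hA1 : 2401 / 2500 * a ^ 2 ≤ A₁) (hA2 : A₁ ≤ 2601 / 2500 * a ^ 2)
    (hB1 : 2401 / 2500 * a ^ 2 ≤ B₁) (hB2 : B₁ ≤ 2601 / 2500 * a ^ 2)
    (hA1' : 2401 / 2500 * a ^ 2 ≤ A₂) (hA2' : A₂ ≤ 2601 / 2500 * a ^ 2)
    (hB1' : 2401 / 2500 * a ^ 2 ≤ B₂) (hB2' : B₂ ≤ 2601 / 2500 * a ^ 2)
    (hD1 : 2401 / 2500 * a ^ 2 ≤ D) (hE : 2401 / 2500 * a ^ 2 ≤ E)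
    (hP₁ : P₁ = (A₁ + D - B₁) / 2) (hP₂ : P₂ = (A₂ + D - B₂) / 2)
    (hs : 0 ≤ s) (ht : 0 ≤ t) (hs2 : s ^ 2 = A₁ - P₁ ^ 2 / D) (ht2 : t ^ 2 = A₂ - P₂ ^ 2 / D) :
    (A₁ + A₂ - E) / 2 - P₁ * P₂ / D ≤ 41 / 100 * (s * t) := by
  have hDpos : 0 < D := lt_of_lt_of_le (by positivity) hD1
  have hDne : D ≠ 0 := hDpos.ne'
  have ha2 : 0 ≤ a ^ 2 := sq_nonneg a
  -- upper bounds on `s², t²`, hence on `s, t`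
  have hs2u : s ^ 2 ≤ 8003 / 10000 * a ^ 2 := hs2 ▸ ffrLens_q_sq_upper ha hA2 hB2 hD1 hP₁
  have ht2u : t ^ 2 ≤ 8003 / 10000 * a ^ 2 := ht2 ▸ ffrLens_q_sq_upper ha hA2' hB2' hD1 hP₂
  have hS : 0 ≤ 179 / 200 * a := by positivity
  have hsS : s ≤ 179 / 200 * a := by
    have h := abs_le_of_sq_le_sq (show s ^ 2 ≤ (179 / 200 * a) ^ 2 by linarith) hS
    rwa [abs_of_nonneg hs] at h
  have htS : t ≤ 179 / 200 * a := by
    have h := abs_le_of_sq_le_sq (show t ^ 2 ≤ (179 / 200 * a) ^ 2 by linarith) hS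
    rwa [abs_of_nonneg ht] at h
  -- the convex planar form on the box `[0, 0.895 a]²`
  have hQ : s ^ 2 + t ^ 2 - 82 / 100 * (s * t) ≤ 118 / 100 * (179 / 200 * a) ^ 2 := by
    linarith [mul_nonneg hs (sub_nonneg.2 hsS), mul_nonneg ht (sub_nonneg.2 htS),
      mul_nonneg (sub_nonneg.2 hsS) (sub_nonneg.2 htS), mul_nonneg hS (sub_nonneg.2 hsS),
      mul_nonneg hs (sub_nonneg.2 htS)]
  -- `|P₁ - P₂| ≤ 0.08 a²`
  have hPd1 : P₁ - P₂ ≤ 2 / 25 * a ^ 2 := by rw [hP₁, hP₂]; linarith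
  have hPd2 : 0 ≤ P₁ - P₂ + 2 / 25 * a ^ 2 := by rw [hP₁, hP₂]; linarith
  have hPP : (P₁ - P₂) ^ 2 ≤ 4 / 625 * a ^ 4 := by
    linarith [mul_nonneg (sub_nonneg.2 hPd1) hPd2]
  -- key: `(P₁ - P₂)² ≤ (0.82 st - s² - t² + E) D`
  have hM : 0 ≤ 82 / 100 * (s * t) - s ^ 2 - t ^ 2 + E - 151 / 10000 * a ^ 2 := by linarith
  have key : (P₁ - P₂) ^ 2 ≤ (82 / 100 * (s * t) - s ^ 2 - t ^ 2 + E) * D := by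
    linarith [mul_nonneg hM hDpos.le, mul_nonneg ha2 (sub_nonneg.2 hD1), pow_pos ha 4]
  -- clear denominators and conclude
  have hs2' : P₁ ^ 2 = (A₁ - s ^ 2) * D := by
    have h : P₁ ^ 2 / D = A₁ - s ^ 2 := by linarith
    rwa [div_eq_iff hDne] at h
  have ht2' : P₂ ^ 2 = (A₂ - t ^ 2) * D := by
    have h : P₂ ^ 2 / D = A₂ - t ^ 2 := by linarith
    rwa [div_eq_iff hDne] at h
  have hrw : (A₁ + A₂ - E) / 2 - P₁ * P₂ / D = ((A₁ + A₂ - E) * D - 2 * (P₁ * P₂)) / (2 * D) := by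
    rw [eq_div_iff (by positivity)]
    field_simp
  rw [hrw, div_le_iff₀ (by positivity)]
  linarith [key, hs2', ht2']

/-! ### The stub -/

/-- **Stub 1 (lens geometry of a bond).** For a bond `(y, w)` (length in `[0.98a, 1.02a]`) and a point
`u` in the band of both ends, the component `q` of `u - y` orthogonal to `w - y` has
`‖q‖² ≥ 0.69 a²`, the axial coefficient is within `21/500` of `1/2`, and two such points `u₁, u₂` at
mutual distance `≥ 0.98a` have projections at angle `≥ arccos (41/100)` about the bond. [folklore] -/
theorem stub_ffrLens :
    ∀ (a : ℝ), 0 < a → ∀ (y w : EuclideanSpace ℝ (Fin 3)),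
      a * (1 - 1 / 50) ≤ dist y w → dist y w ≤ a * (1 + 1 / 50) →
      (∀ u : EuclideanSpace ℝ (Fin 3),
          a * (1 - 1 / 50) ≤ dist y u → dist y u ≤ a * (1 + 1 / 50) →
          a * (1 - 1 / 50) ≤ dist w u → dist w u ≤ a * (1 + 1 / 50) →
          inner ℝ ((u - y) - (inner ℝ (u - y) (w - y) / inner ℝ (w - y) (w - y)) • (w - y)) (w - y) = 0 ∧
          |inner ℝ (u - y) (w - y) / inner ℝ (w - y) (w - y) - 1 / 2| ≤ 21 / 500 ∧
          69 / 100 * a ^ 2 ≤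
            ‖(u - y) - (inner ℝ (u - y) (w - y) / inner ℝ (w - y) (w - y)) • (w - y)‖ ^ 2) ∧
      (∀ u₁ u₂ : EuclideanSpace ℝ (Fin 3),
          a * (1 - 1 / 50) ≤ dist y u₁ → dist y u₁ ≤ a * (1 + 1 / 50) →
          a * (1 - 1 / 50) ≤ dist w u₁ → dist w u₁ ≤ a * (1 + 1 / 50) →
          a * (1 - 1 / 50) ≤ dist y u₂ → dist y u₂ ≤ a * (1 + 1 / 50) →
          a * (1 - 1 / 50) ≤ dist w u₂ → dist w u₂ ≤ a * (1 + 1 / 50) →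
          a * (1 - 1 / 50) ≤ dist u₁ u₂ →
          inner ℝ ((u₁ - y) - (inner ℝ (u₁ - y) (w - y) / inner ℝ (w - y) (w - y)) • (w - y))
              ((u₂ - y) - (inner ℝ (u₂ - y) (w - y) / inner ℝ (w - y) (w - y)) • (w - y)) ≤
            41 / 100 * (‖(u₁ - y) - (inner ℝ (u₁ - y) (w - y) / inner ℝ (w - y) (w - y)) • (w - y)‖ *
              ‖(u₂ - y) - (inner ℝ (u₂ - y) (w - y) / inner ℝ (w - y) (w - y)) • (w - y)‖)) := by
  intro a ha y w hyw1 hyw2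
  -- the bond: `D = ⟪w - y, w - y⟫ = dist y w ^ 2 ∈ [0.9604 a², 1.0404 a²]`
  have hDd : inner ℝ (w - y) (w - y) = dist y w ^ 2 := by
    rw [real_inner_self_eq_norm_sq, ← dist_eq_norm, dist_comm]
  obtain ⟨hD1, hD2⟩ := ffrLens_sq_window ha hyw1 hyw2
  rw [← hDd] at hD1 hD2
  have hDpos : 0 < inner ℝ (w - y) (w - y) := lt_of_lt_of_le (by positivity) hD1
  have hDne : inner ℝ (w - y) (w - y) ≠ 0 := hDpos.ne'
  -- per-partner scalar facts: `A = ‖u - y‖²`, `B = ‖(u - y) - (w - y)‖²`, `P = ⟪u - y, w - y⟫`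
  have partner : ∀ u : EuclideanSpace ℝ (Fin 3),
      a * (1 - 1 / 50) ≤ dist y u → dist y u ≤ a * (1 + 1 / 50) →
      a * (1 - 1 / 50) ≤ dist w u → dist w u ≤ a * (1 + 1 / 50) →
      (2401 / 2500 * a ^ 2 ≤ ‖u - y‖ ^ 2 ∧ ‖u - y‖ ^ 2 ≤ 2601 / 2500 * a ^ 2) ∧
      (2401 / 2500 * a ^ 2 ≤ ‖(u - y) - (w - y)‖ ^ 2 ∧
        ‖(u - y) - (w - y)‖ ^ 2 ≤ 2601 / 2500 * a ^ 2) ∧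
      inner ℝ (u - y) (w - y) =
        (‖u - y‖ ^ 2 + inner ℝ (w - y) (w - y) - ‖(u - y) - (w - y)‖ ^ 2) / 2 := by
    intro u h1 h2 h3 h4
    have hA : ‖u - y‖ = dist y u := by rw [dist_comm, dist_eq_norm]
    have hB : ‖(u - y) - (w - y)‖ = dist w u := by
      rw [sub_sub_sub_cancel_right, dist_comm, dist_eq_norm]
    have hP : inner ℝ (u - y) (w - y) =
        (‖u - y‖ ^ 2 + inner ℝ (w - y) (w - y) - ‖(u - y) - (w - y)‖ ^ 2) / 2 := by
      rw [ffrLens_inner_eq_norm (u - y) (w - y), real_inner_self_eq_norm_sq]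
    refine ⟨?_, ?_, hP⟩
    · rw [hA]; exact ffrLens_sq_window ha h1 h2
    · rw [hB]; exact ffrLens_sq_window ha h3 h4
  refine ⟨fun u h1 h2 h3 h4 => ?_, fun u₁ u₂ h1 h2 h3 h4 h5 h6 h7 h8 h9 => ?_⟩
  · obtain ⟨⟨hA1, hA2⟩, ⟨hB1, hB2⟩, hP⟩ := partner u h1 h2 h3 h4
    refine ⟨ffrLens_inner_proj _ _ hDne, ffrLens_alpha_abs ha hA1 hA2 hB1 hB2 hD1 hP, ?_⟩
    rw [ffrLens_norm_proj_sq _ _ hDne]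
    exact ffrLens_q_sq_lower ha hA1 hA2 hB1 hB2 hD1 hD2 hP
  · obtain ⟨⟨hA1, hA2⟩, ⟨hB1, hB2⟩, hP1⟩ := partner u₁ h1 h2 h3 h4
    obtain ⟨⟨hA1', hA2'⟩, ⟨hB1', hB2'⟩, hP2⟩ := partner u₂ h5 h6 h7 h8
    rw [ffrLens_inner_proj_proj _ _ _ hDne, ffrLens_inner_eq_norm (u₁ - y) (u₂ - y)]
    have hE : 2401 / 2500 * a ^ 2 ≤ ‖(u₁ - y) - (u₂ - y)‖ ^ 2 := by
      rw [sub_sub_sub_cancel_right, ← dist_eq_norm]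
      have h0 : (0 : ℝ) ≤ a * (1 - 1 / 50) := by positivity
      have hl := mul_le_mul h9 h9 h0 (h0.trans h9)
      linarith [hl]
    have hs := norm_nonneg ((u₁ - y) - (inner ℝ (u₁ - y) (w - y) / inner ℝ (w - y) (w - y)) • (w - y))
    have ht := norm_nonneg ((u₂ - y) - (inner ℝ (u₂ - y) (w - y) / inner ℝ (w - y) (w - y)) • (w - y))
    have hs2 := ffrLens_norm_proj_sq (u₁ - y) (w - y) hDne
    have ht2 := ffrLens_norm_proj_sq (u₂ - y) (w - y) hDne
    exact ffrLens_pair_core ha hA1 hA2 hB1 hB2 hA1' hA2' hB1' hB2' hD1 hE hP1 hP2 hs ht hs2 ht2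

end Summit.AtomisticToContinuum.Crystallization.Theorems

end
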